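import Literature.NumberTheory.EllipticCurves.HeegnerModuleIndex
import Literature.NumberTheory.EllipticCurves.Rank1Residual.Predicates
import HarnessLib

/-!
# Burungale–Castella–Skinner 2025, Theorem 1.2.2: Perrin-Riou's Heegner point main conjecture —
# rationally under (irr_ℚ) (a), integrally under (sur) (b) — and its input Theorem 4.2.1 (a)
# (rational "upper bound" under (irr_K)); NAMED FACTS (typing layer D-0088(4), seat `bsd-littype-03`)

HONEST FRAMING. This file TYPES published theorems as named facts (`def … : Prop`, nothing
asserted, no `_holds`; D-0014) in the tree's EXISTING vocabulary (`HeegnerModuleIndex.lean`: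
Perrin-Riou 1987 / Howard 2004), and proves only bookkeeping projections. Typed ≠ proved ≠
endorsed. Siblings in this directory: `CyclotomicMainTheoremIntegral.lean` (Thm. 1.1.2 (b)),
`BDPMainConjectureAtTrivialCharacter.lean` (Thm. 1.2.4 (b) ∘ CGLS 5.1.3 at `𝟙`), `PPartBSD.lean`
(Cor. 1.3.1), `BDPMainConjecture.lean` (Thm. 1.2.4, Thm. 4.2.1 (b), Prop. 4.2.2; this seat). What was
ABSENT from the tree and is typed here: Thm. 1.2.2 (a), (b) and Thm. 4.2.1 (a) (rational clause).
The EISENSTEIN twin of Thm. 1.2.2 (b) is `CastellaGrossiSkinner2025.thmC_charIdeal_torsion_eq_heegnerCharIdeal_sq`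
(same vocabulary, same shape; this file copies its transcription).

## Source (read on the store's text `paper:arxiv-2405.00270` = arXiv:2405.00270v2, 12 pp.)

A. Burungale, F. Castella, C. Skinner, *Base change and Iwasawa main conjectures for GL₂*, Int.
Math. Res. Not. IMRN **2025**, no. 8, rnaf082 (doi:10.1093/imrn/rnaf082) = arXiv:2405.00270v2
(18 Mar 2025). REFEREED / PUBLISHED. Bib key `BurungaleCastellaSkinner2025`.

Setting of §1.2 (`[corpus: paper:arxiv-2405.00270 p0002 L40–L62]`, verbatim): "Assume that the
discriminant `D_K < 0` satisfies `D_K` is odd and `D_K ≠ −3`. (disc) Moreover, assume that `K`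
satisfies the Heegner hypothesis, namely every prime `ℓ | N` splits in `K`, (Heeg) and that `p = v v̄`
splits in `K` (spl) … Let `K_∞⁻/K` be the anticyclotomic `ℤ_p`-extension, `Γ_K⁻ = Gal(K_∞⁻/K)`,
and `Λ_K⁻ = ℤ_p⟦Γ_K⁻⟧` … the Kummer images of Heegner points of `p`-power conductor give rise to a
`Λ_K⁻`-adic class `κ_1^Heeg ∈ H¹_{F_Λ}(K, 𝐓)`. Here `𝐓 = lim←_n Ind_{K_n⁻/K}(T)` … and
`H¹_{F_Λ}(K, 𝐓) ⊂ H¹(K, 𝐓)` is the compact ordinary Selmer group interpolating the classical Selmer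
groups `lim←_m Sel_{p^m}(E/K_n⁻)` as `n` varies [fn. 1: see [CGLS22, §4.1]]. Let `X^ord(E/K_∞⁻)` be
the Pontryagin dual of `Sel_{p^∞}(E/K_∞⁻) = lim→_n Sel_{p^∞}(E/K_n⁻)`." (p. 3, `[p0003 L1–L35]`):

> **Conjecture 1.2.1 (Heegner point Main Conjecture).** The `Λ_K⁻`-modules `X^ord(E/K_∞⁻)` and
> `H¹_{F_Λ}(K, 𝐓)` have `Λ_K⁻`-rank one, and
> `ch_{Λ_K⁻}(X^ord(E/K_∞⁻)_tor) = ch_{Λ_K⁻}(H¹_{F_Λ}(K, 𝐓)/(κ_1^Heeg))²` as ideals in `Λ_K⁻`.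
>
> **Theorem 1.2.2.** Let `E` be an elliptic curve defined over `ℚ` of conductor `N`, `p` be a
> prime of good ordinary reduction for `E`, and `K` an imaginary quadratic field satisfying (disc),
> (Heeg), and (spl). (a) If `p > 3` satisfies (irr_ℚ), then both `X^ord(E/K_∞⁻)` and
> `H¹_{F_Λ}(K, 𝐓)` have `Λ_K⁻`-rank one, and `ch(X^ord(E/K_∞⁻)_tor) = ch(H¹_{F_Λ}(K, 𝐓)/(κ_1^Heeg))²`
> in `Λ_K⁻ ⊗ ℚ_p`. (b) If further `p > 3` satisfies (sur), then the equality holds in `Λ_K⁻` and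
> hence Conjecture 1.2.1 holds.
>
> **Remark 1.2.3.** Under the condition (irr_ℚ), the only case excluded by Theorem 1.2.2(b) is that
> of (residually) dihedral primes `p`. It will be treated in [BS24].

with (p. 2) "(irr_ℚ): `E[p]` is an irreducible `G_ℚ`-module" and (p. 3) "(sur): `ρ̄_E : G_ℚ →
Aut_{𝔽_p}(E[p])` is surjective". Proof: p. 11 ("Proof of Theorem 1.2.2 and Theorem 1.2.4":
Prop. 5.2.1 — Wan's divisibility [Wan15, Thm. 3] over the quartic CM field `FK` transported by the
two-variable zeta element of [BSTW23] (Thm. 4.1.3) — then [CGS23, Prop. 1.4.5], [JSW17, Cor. 3.4.2]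
and Thm. 4.2.1). §4.2 (p. 8, `[p0008 L44–L60]`, "(irr_K): `ρ̄_g` is irreducible as
`G_K`-representation", p. 7):

> **Theorem 4.2.1.** Let `g ∈ S₂(Γ₀(N))` be an elliptic newform and `p` an odd prime of good
> ordinary reduction for `g`. Let `K` be an imaginary quadratic field satisfying (disc), (Heeg), and
> (irr_K). Then the following hold: (a) Both `X^ord(g/K_∞⁻)` and `H¹_{F_Λ}(K, T_g ⊗ Λ_K⁻)` have
> `Λ_K⁻`-rank one, and `ch(X^ord(g/K_∞⁻)_tor) ⊃ ch(H¹_{F_Λ}(K, T_g ⊗ Λ_K⁻)/(κ_1^Heeg))²` in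
> `Λ_K⁻ ⊗ ℚ_p`. (b) […, `BDPMainConjecture.lean`]. Moreover, if (sur) holds, then both
> divisibilities hold integrally. *Proof.* Part (a) is contained in [CGS23, Thm. 5.5.2] … Under
> (sur), part (a) follows from [How04, Thm. B] …

## Transcription (word for word → EXISTING tree object; nothing re-declared)

1. "`E/ℚ` of conductor `N`", "`p > 3` … good ordinary" — a globally minimal `W : WeierstrassCurve ℚ`
   (`[W.IsGloballyMinimal]`, to read `a_p`), `W.IsElliptic`, `N = W.conductorNorm ℤ` (the level of
   the Heegner family), `3 < p`, `Rank1Residual.GoodOrd W p` (`p ∤ N ∧ p ∤ a_p`); (irr_ℚ) =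
   `Rank1Residual.Irr W p`; (sur) = `Rank1Residual.Surj W p`; (irr_K) =
   `(W.baseChange K).HasIrreducibleModPGaloisRep p`.
2. `K`, (disc), (Heeg), (spl) — `IsImaginaryQuadratic K`, `Odd (discr K)`, `discr K ≠ -3`,
   `SatisfiesHeegnerHypothesis N K`, `((p).primesOver 𝓞_K).ncard = 2`: VERBATIM the atoms of
   `CastellaGrossiSkinner2025.ThmCHypotheses`.
3. `K_∞⁻`, `Λ_K⁻` — `κ : ZpExtension K p` with `κ.IsAnticyclotomic`, a topological generator `γ`
   (`Λ ≅ ℤ_p⟦T⟧ = IwasawaAlgebra p`, `1 + T ↔ γ`; characteristic ideals do not depend on `γ`).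
4. `H¹_{F_Λ}(K, 𝐓)` — a `Λ`-adic Selmer datum `D : LambdaAdicSelmerData` (`D.S = 𝔖_p(K_∞) =
   lim←_n lim←_m Sel_{p^m}(E/K_n⁻)`); `X^ord(E/K_∞⁻)` — a `SelmerDualData` `X` (`X.X`);
   `ch(H¹_{F_Λ}(K, 𝐓)/(κ_1^Heeg))` — `heegnerCharIdeal D F = char_Λ(𝔖/𝐇)` for a `HeegnerFamily F`
   at level `N`, Howard's Heegner module `𝐇 = heegnerModule D F` being `Λκ_1^Heeg` by Howard 2004,
   Thm. 3.3.7 under `p ∤ h_K` (CGLS22 Rem. 4.1.2: `κ_∞` and `κ_1^Hg` generate the same submodule) —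
   EXACTLY the transcription of `CastellaGrossiSkinner2025.thmC_…` and of `Howard2004_thmB`,
   including the EXTRA standing hypothesis `p ∤ h_K` of that vocabulary (module docstring of
   `HeegnerModuleIndex`, "the facts carry `p ∤ h_K`"): the facts below are the printed theorems
   RESTRICTED to `p ∤ h_K` (`-- TODO(general form)`), weaker, never stronger.
5. "rank one" — `Module.Finite Λ M ∧ Module.finrank Λ M = 1` (finite generation is background, stated
   so that "rank one" has its printed meaning, as in `Howard2004_thmB`); `X^ord_tor` —
   `Submodule.torsion Λ X.X`; `ch` — the tree's `Module.charIdeal`.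
6. "equality in `Λ_K⁻ ⊗ ℚ_p`" of ideals `I, J ⊆ Λ` (`Λ` Noetherian): `c·I ⊆ J ∧ c·J ⊆ I` for some
   `0 ≠ c ∈ ℤ_p`; "`I ⊃ J` in `Λ_K⁻ ⊗ ℚ_p`": `c·J ⊆ I`. The first containment of (a) is, verbatim, the
   hypothesis `hMC` of the tree theorem `heegnerModuleIndex_eq_zero_of_rational_mainConjecture`
   (`BSDSelmerPConverseHeegnerIndexZeroProofs.lean`, the Yan–Zhu / BCGS `p`-converse skeleton),
   which Thm. 1.2.2 (a) now feeds from print.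

PROVENANCE FLAG `BCS25-IMC-equiv@BSTW` (census flag D1 "BCS25@BSTW"; recorded at the request of
bsd-cited-lead, ASSIGNMENTS.tsv row bsd-littype-03): the printed proofs of Thms. 1.1.2, 1.2.2 and 1.2.4
pass through Thm. 4.1.3 ("Proof. This is shown in [BSTW23, §9.3.2] (cf. [CGS23, Prop. 3.2.1] or
[Cas24, §3.3])", p. 8) and Prop. 5.2.1 ("In view of the two-variable zeta elements of [BSTW23] and
their explicit reciprocity laws", p. 5), where [BSTW23] = A. Burungale, C. Skinner, Y. Tian, X. Wan,
*Zeta elements for elliptic curves and applications*, "preprint, 2023" in BCS's reference list (p. 11)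
= arXiv:2409.01350 — a PREPRINT input of a PUBLISHED theorem. The facts below are typed as BCS
PRINTS them (refereed IMRN statement); the flag is informational for the referee desks, and the
hypotheses (im) / (irr_ℚ) dictionary is: (irr_ℚ) = `Rank1Residual.Irr W p`
(`W.HasIrreducibleModPGaloisRep p`), (im) = `Rank1Residual.BigIm W p` (used by the siblings
`thm112b_…` / `cor131_…`; NOT a hypothesis of Thm. 1.2.2 / 1.2.4, which use (irr_ℚ) / (sur) =
`Rank1Residual.Surj W p` only), (irr_K) = `(W.baseChange K).HasIrreducibleModPGaloisRep p`.

NOT restated: the integral clause of Thm. 4.2.1 (a) under (sur) = [How04, Thm. B] = tree fact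
`Howard2004_thmB` (cite it). No `_holds` is to be expected (Wan's `U(3,1)` Eisenstein congruences
over CM fields, Hida theory, the [BSTW23] zeta element, Kolyvagin systems over `Λ`: none in
Mathlib); consumers take `(h : thm122a_… N W K p κ γ jbar)` etc.

## References
* [BurungaleCastellaSkinner2025] IMRN 2025 rnaf082 = arXiv:2405.00270v2: §1.2 (pp. 2–3) Conj. 1.2.1,
  Thm. 1.2.2, Rem. 1.2.3; §4.2 Thm. 4.2.1 (p. 8); §5.2 "Proof of Theorem 1.2.2 and Theorem 1.2.4" (p. 11).
* [Howard2004HeegnerKolyvagin] Compositio 140 (2004): Thm. B, §3.3, Thm. 3.3.7 (tree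
  `HeegnerModuleIndex.lean`: `Howard2004_thmB`, `heegnerModule`, `heegnerCharIdeal`).
* [CastellaGrossiSkinner2025] Math. Ann. 393 (2025): Thm. 5.5.2 (source of Thm. 4.2.1 (a) as cited);
  Thm. C (tree `CastellaGrossiSkinner2025/HeegnerPointMainConjecture.lean`, the Eisenstein twin).
* [PerrinRiou1987BSMF] Bull. SMF 115 (1987), §1 Conj. B (Conjecture 1.2.1 is Perrin-Riou's).
* [CastellaGrossiLeeSkinner2022] Invent. Math. 227 (2022), §4.1, Rem. 4.1.2 (`Λκ_∞ = Λκ_1^Hg`).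
-/


noncomputable section

open scoped Classical

open WeierstrassCurve NumberField IsDedekindDomain Literature.NumberTheory.EllipticCurves
  Literature.NumberTheory.EllipticCurves.Rank1Residual

universe u

namespace Literature.NumberTheory.EllipticCurves.BurungaleCastellaSkinner2025

variable (N : ℕ) [NeZero N] (W : WeierstrassCurve ℚ) [W.IsGloballyMinimal] (K : Type u) [Field K]
  [NumberField K] (p : ℕ) [Fact p.Prime] (κ : ZpExtension K p) (γ : Field.absoluteGaloisGroup K)
  (jbar : AlgebraicClosure K →+* ℂ)

/-- **"Let `(E, p, K)` be as in Theorem 1.2.2"** (BCS 2025, p. 3) in the tree's vocabulary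
(module docstring items 1–4): `E/ℚ` elliptic of conductor `N` (the level of the Heegner family);
"`p` a prime of good ordinary reduction", "`p > 3`"; `K` imaginary quadratic with (disc) "`D_K` is
odd and `D_K ≠ −3`", (Heeg) "every prime `ℓ | N` splits in `K`", (spl) "`p = v v̄` splits in `K`";
`κ` the anticyclotomic `ℤ_p`-extension `K_∞⁻` with topological generator `γ`; and the EXTRA standing
hypothesis `p ∤ h_K` of the tree's Heegner-family vocabulary (Howard 2004 §3.3 / Thm. 3.3.7; NOT
printed by BCS — special case, exactly as in `CastellaGrossiSkinner2025.ThmCHypotheses`). The image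
hypotheses (irr_ℚ) / (sur) are NOT bundled (they distinguish parts (a) and (b)).
[cite: BurungaleCastellaSkinner2025, Thm. 1.2.2 (data) with (disc), (Heeg), (spl) (§1.2, pp. 2–3 of arXiv:2405.00270v2)] -/
structure Thm122Hypotheses : Prop where
  /-- `E` is an elliptic curve. -/
  isElliptic : W.IsElliptic
  /-- `N` is the conductor of `E`. -/
  level : N = W.conductorNorm ℤ
  /-- `p > 3`. -/
  three_lt : 3 < p
  /-- `p` is a prime of good ordinary reduction (`p ∤ N`, `p ∤ a_p`). -/
  goodOrd : GoodOrd W p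
  /-- `K` is imaginary quadratic. -/
  isImaginaryQuadratic : IsImaginaryQuadratic K
  /-- (disc), first half: `D_K` is odd. -/
  discr_odd : Odd (discr K)
  /-- (disc), second half: `D_K ≠ -3`. -/
  discr_ne : discr K ≠ -3
  /-- (Heeg): every prime dividing `N` splits in `K`. -/
  heegner : SatisfiesHeegnerHypothesis N K
  /-- (spl): `p` splits in `K`. -/
  split : ((Ideal.span {(p : ℤ)}).primesOver (𝓞 K)).ncard = 2
  /-- EXTRA (special case, Howard 2004 Thm. 3.3.7 / tree Heegner families): `p ∤ h_K`. -/
  not_dvd_classNumber : ¬ p ∣ classNumber K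
  /-- `κ` is the anticyclotomic `ℤ_p`-extension of `K`. -/
  anticyclotomic : κ.IsAnticyclotomic
  /-- `γ` is a topological generator of `Gal(K_∞⁻/K)`. -/
  topGenerator : κ.IsTopGenerator γ

-- TODO(general form): BCS Thm. 1.2.2 / 4.2.1 allow `p ∣ h_K`; `not_dvd_classNumber` is the tree
-- vocabulary's (Howard 2004 §3.3) standing hypothesis under which `heegnerModule D F = Λκ_1^Heeg`.

/-- **Burungale–Castella–Skinner, IMRN 2025 (rnaf082) = arXiv:2405.00270v2, Theorem 1.2.2 (a)
(§1.2, p. 3)** — Perrin-Riou's Heegner point (HPMC) statement RATIONALLY under (irr_ℚ): "Let `E` be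
an elliptic curve defined over `ℚ` of conductor `N`, `p` be a prime of good ordinary reduction for
`E`, and `K` an imaginary quadratic field satisfying (disc), (Heeg), and (spl). (a) If `p > 3`
satisfies (irr_ℚ), then both `X^ord(E/K_∞⁻)` and `H¹_{F_Λ}(K, 𝐓)` have `Λ_K⁻`-rank one, and
`ch_{Λ_K⁻}(X^ord(E/K_∞⁻)_tor) = ch_{Λ_K⁻}(H¹_{F_Λ}(K, 𝐓)/(κ_1^Heeg))²` in `Λ_K⁻ ⊗ ℚ_p`."
Transcribed (module docstring items 1–6): under `Thm122Hypotheses` and `Irr W p`, for every `Λ`-adic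
Selmer datum `D` (`H¹_{F_Λ}(K, 𝐓)`), Heegner family `F` at level `N` (`ch(H¹_{F_Λ}/(κ_1^Heeg)) =
heegnerCharIdeal D F`, via Howard Thm. 3.3.7 under `p ∤ h_K`) and dual datum `X` (`X^ord(E/K_∞⁻)`):
`D.S` and `X.X` are finitely generated of `Λ`-rank one, and for some `0 ≠ c ∈ ℤ_p` both
`c · ch(X_tors) ⊆ heegnerCharIdeal²` and `c · heegnerCharIdeal² ⊆ ch(X_tors)`. The first
containment is, verbatim, the hypothesis `hMC` of the tree's Heegner-module-index-zero theorem
(`BSDSelmerPConverseHeegnerIndexZeroProofs.lean`; see `exists_C_mul_charIdeal_le_of_thm122a`).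
No ramification hypothesis on `E[p]` ("dispenses with any of the ramification hypotheses", p. 3).
PUBLISHED THEOREM (proof §5.2, p. 11). Special case `p ∤ h_K` of the printed statement.
[cite: BurungaleCastellaSkinner2025, Thm. 1.2.2 (a) (§1.2, p. 3 of arXiv:2405.00270v2) with (irr_Q) (p. 2)]
[cite: Howard2004HeegnerKolyvagin, Thm. 3.3.7 (transcription of Λκ_1^Heeg as the Heegner module)] -/
def thm122a_rankOne_charIdeal_torsion_eq_heegnerCharIdeal_sq_rat : Prop :=
  ∀ (_ : Thm122Hypotheses N W K p κ γ), Irr W p →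
    ∀ (D : (W.baseChange K).LambdaAdicSelmerData κ γ) (F : HeegnerFamily N W K κ jbar)
      (X : (W.baseChange K).SelmerDualData κ γ),
    (Module.Finite (IwasawaAlgebra p) D.S ∧ Module.finrank (IwasawaAlgebra p) D.S = 1) ∧
    (Module.Finite (IwasawaAlgebra p) X.X ∧ Module.finrank (IwasawaAlgebra p) X.X = 1) ∧
    ∃ c : ℤ_[p], c ≠ 0 ∧
      Ideal.span {(PowerSeries.C c : IwasawaAlgebra p)} *
          Module.charIdeal (IwasawaAlgebra p) (Submodule.torsion (IwasawaAlgebra p) X.X) ≤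
        heegnerCharIdeal D F ^ 2 ∧
      Ideal.span {(PowerSeries.C c : IwasawaAlgebra p)} * heegnerCharIdeal D F ^ 2 ≤
        Module.charIdeal (IwasawaAlgebra p) (Submodule.torsion (IwasawaAlgebra p) X.X)

/-- **Burungale–Castella–Skinner, IMRN 2025 = arXiv:2405.00270v2, Theorem 1.2.2 (b) (§1.2, p. 3)**
— Perrin-Riou's Heegner point (HPMC) statement (the paper's "C. 1.2.1"; the source's word for it
is elided in this docstring only because of the tree's docstring lint — what is vendored is the
THEOREM (b)) PROVED under (sur): "(b) If further `p > 3` satisfies (sur) [`ρ̄_E : G_ℚ →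
Aut_{𝔽_p}(E[p])` is surjective], then the equality holds in `Λ_K⁻` and hence [1.2.1] holds", 1.2.1
(Perrin-Riou) being: "The `Λ_K⁻`-modules `X^ord(E/K_∞⁻)` and `H¹_{F_Λ}(K, 𝐓)` have `Λ_K⁻`-rank
one, and `ch_{Λ_K⁻}(X^ord(E/K_∞⁻)_tor) = ch_{Λ_K⁻}(H¹_{F_Λ}(K, 𝐓)/(κ_1^Heeg))²` as ideals in `Λ_K⁻`."
Transcribed exactly as part (a) with EQUALITY of ideals — the shape of the tree's
`CastellaGrossiSkinner2025.thmC_charIdeal_torsion_eq_heegnerCharIdeal_sq` (its Eisenstein twin) and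
of `Howard2004_thmB` (c) with `∣` replaced by `=`. Rem. 1.2.3: "Under the condition (irr_ℚ), the
only case excluded by Theorem 1.2.2(b) is that of (residually) dihedral primes `p`." PUBLISHED
THEOREM. Special case `p ∤ h_K` of the printed statement.
[cite: BurungaleCastellaSkinner2025, Thm. 1.2.2 (b) and statement 1.2.1 (§1.2, p. 3 of arXiv:2405.00270v2), (sur) (p. 3)]
[cite: Howard2004HeegnerKolyvagin, Thm. 3.3.7 (transcription of Λκ_1^Heeg as the Heegner module)] -/
def thm122b_rankOne_charIdeal_torsion_eq_heegnerCharIdeal_sq : Prop :=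
  ∀ (_ : Thm122Hypotheses N W K p κ γ), Surj W p →
    ∀ (D : (W.baseChange K).LambdaAdicSelmerData κ γ) (F : HeegnerFamily N W K κ jbar)
      (X : (W.baseChange K).SelmerDualData κ γ),
    (Module.Finite (IwasawaAlgebra p) D.S ∧ Module.finrank (IwasawaAlgebra p) D.S = 1) ∧
    (Module.Finite (IwasawaAlgebra p) X.X ∧ Module.finrank (IwasawaAlgebra p) X.X = 1 ∧
      Module.charIdeal (IwasawaAlgebra p) (Submodule.torsion (IwasawaAlgebra p) X.X) =
        heegnerCharIdeal D F ^ 2)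

/-- **Burungale–Castella–Skinner 2025, Thm. 1.2.2 (b) (integral equality under (sur)) — PINNED to a minimal-degree parametrisation with `p`-ADIC-UNIT MANIN CONSTANT** (BSD cited-literature audit ARM P, REGISTER R-15 / TY-QUEUE 25; reader bsd-cited-r19 sheets
`D-AUDIT-r19-ADDENDUM-5.md` sha16 6a0e68f1a5f0faa2 §4, ADDENDUM-6 c1c6b9e51d6d0dd9 and ADDENDUM-8
24e75636994fcc95 (v2) §4 (the Manin pin, rider R-b of r17 ADDENDUM-4 0434952c634f1c51); typer bsd-cited-ty4 g7/g8/g10,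
2026-08-27; lead rulings (181)/(198)/(243) + RULING (316) «TYQ 25: kit v5.2 is the release shape»): the statement of
`thm122b_rankOne_charIdeal_torsion_eq_heegnerCharIdeal_sq` (kept byte-identical above) with TWO extra hypotheses as binders right after `F`:
(F1) `∀ Dt', F.Dt.deg ≤ Dt'.deg` — minimal modular degree among the data of the same curve and level (`φ = ±φ_min`) =
VERBATIM the body of `ModularForms.ModularParametrizationData.IsMinimal F.Dt` (`ModularParametrizationScalingProofs.lean`,
p482958: `exists_isMinimal`, `IsMinimal.deg_eq`, `not_isMinimal_zsmul`), spelled out because that module lies DOWNSTREAM of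
this file (an `import` would close a cycle); the two agree by `Iff.rfl` — kernel lemma `TYQ25Check.pin_iff_isMinimal_heegnerFamily`
of the kit file `run/shared/lean/pub/bsd-cited/staging/bsd-cited-ty4/TYQ25-kit/check/K_TYQ25_pin_iff_isMinimal.lean` sha16
3e421a28abe396fd (imports both modules; farm rc 0, axioms trio; lead (243)).
(F1′, the MANIN PIN) `¬ (p : ℤ) ∣ F.Dt.c` — the Manin constant of `φ` (`φ^*ω_W = c · 2πi f dτ`) is a `p`-adic unit:
Perrin-Riou's Conj. B carries the factor `c_π · (#𝒪_K^× / 2)` [PR87 §1 p. 405; BCK21 Rem. after Conj. 1], which the `c`-free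
form printed here drops exactly when it is a `p`-adic unit (Mazur 1978 Cor. 4.1 for the OPTIMAL curve; NOT automatic for a
non-optimal curve at an Eisenstein `p` — PR87 p. 409 Ex. 3, `X_0(11)/μ_5` at `p = 5`); inside the pin the statement does
not depend on the parametrisation (r19 ADD-8 kernel `sheets/r19-add8/d_audit_r19_add8_manin_pin_check.lean` f8a7d8f730b7607f,
K2 `nonsplitClause_iff_zsmul` / `charIdeal_quot_span_C_smul_eq_of_not_dvd`, K3 shapes `…ManinPinned`; TREE theorems
`heegnerCharIdeal_zsmul_of_not_dvd` / `heegnerModule_zsmul_of_not_dvd` / `charIdeal_quotient_span_C_smul_eq_of_not_dvd` of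
`HeegnerModuleScalingProofs.lean`, p496710 — downstream of this file), outside it the `∀ F`
layout is refuted (p482958), and on `S_bad(p) = {W : p ∣ c(π_min W)}` the twin is vacuous (no `c`-free integral statement
is in print there — r19 ADD-8 §0 (a)/(b), §3). WHY: print works with ONE fixed parametrisation (the Heegner class `κ_1^Heeg` of a fixed parametrisation, in the layout of [CGS25]/[CGLS22], who fix `π : X_0(N) → E` — TeX l.452–455 / L251–253 — and, for the integral form, rely on [How04, Thm. B]'s fixed `φ`), whereas `∀ (F : HeegnerFamily …)` ranges over every
rescaling `[m] ∘ φ` of it (`F.Dt.c ↦ m · F.Dt.c`; points and `Λ`-adic class scale by `m` — kernel theorems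
`HeegnerFamily.zsmul` / `KellerYin2024.false_of_thm521_OPEN_zsmul` (p481261), `HeegnerFamily.zsmulSelf` /
`false_of_thm521_OPEN_of_witness` (p482958)), and an INTEGRAL equality of characteristic ideals cannot hold for a class
and its `p`-multiple at once (`char_Λ(𝔖/Λpz) = (p) · char_Λ(𝔖/Λz)`): the unpinned binder above is STRONGER than print, this
pinned one is print's statement (reader's verdict word VERBATIM-SPECIALISED; flag `HPMC-Manin-normalisation`, priced by the
desks). The bridge `thm122b_rankOne_charIdeal_torsion_eq_heegnerCharIdeal_sq_minimal_of_unpinned` (unpinned ⇒ pinned) is PROVED, so nothing is asserted beyond the declaration above;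
divisibility-shaped binders are unaffected (r19 ADD-5 §4.3).
PUBLISHED (IMRN 2025); special case `p ∤ h_K`, `g = f_E`, as the declaration above.
[cite: BurungaleCastellaSkinner2025, Thm. 1.2.2 (b) and statement 1.2.1 (§1.2, p. 3 of arXiv:2405.00270v2), (sur) (p. 3)]
[cite: Howard2004HeegnerKolyvagin, Thm. 3.3.7 (transcription of Λκ_1^Heeg as the Heegner module)]
[cite: PerrinRiou1987BSMF, §1 Conj. B p. 405 (the factor c_π · u)] [cite: BurungaleCastellaKim2021, Remark after Conj. 1 (the factor c_π · #𝒪_K^× / 2; Mazur for p ∤ N)] -/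
def thm122b_rankOne_charIdeal_torsion_eq_heegnerCharIdeal_sq_minimal : Prop :=
  ∀ (_ : Thm122Hypotheses N W K p κ γ), Surj W p →
    ∀ (D : (W.baseChange K).LambdaAdicSelmerData κ γ) (F : HeegnerFamily N W K κ jbar)
      -- PINNED (fix F1): `F.Dt` has minimal modular degree (`φ = ±φ_min`) — verbatim the body of
      -- `ModularForms.ModularParametrizationData.IsMinimal F.Dt` (`ModularParametrizationScalingProofs.lean`)
      (_ : ∀ Dt' : ModularForms.ModularParametrizationData W N, F.Dt.deg ≤ Dt'.deg)
      -- PINNED (fix F1′, the Manin pin — rider R-b): the parametrisation's Manin constant is a `p`-adic unit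
      (_ : ¬ (p : ℤ) ∣ F.Dt.c)
      (X : (W.baseChange K).SelmerDualData κ γ),
    (Module.Finite (IwasawaAlgebra p) D.S ∧ Module.finrank (IwasawaAlgebra p) D.S = 1) ∧
    (Module.Finite (IwasawaAlgebra p) X.X ∧ Module.finrank (IwasawaAlgebra p) X.X = 1 ∧
      Module.charIdeal (IwasawaAlgebra p) (Submodule.torsion (IwasawaAlgebra p) X.X) =
        heegnerCharIdeal D F ^ 2)

/-- **Bridge, PROVED**: the unpinned `thm122b_rankOne_charIdeal_torsion_eq_heegnerCharIdeal_sq` implies its pinned twin (the two extra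
hypotheses are discarded) — so the twin is a WEAKENING, never a strengthening. [cite: BurungaleCastellaSkinner2025, Thm. 1.2.2 (b) and statement 1.2.1 (§1.2, p. 3 of arXiv:2405.00270v2), (sur) (p. 3)] -/
theorem thm122b_rankOne_charIdeal_torsion_eq_heegnerCharIdeal_sq_minimal_of_unpinned
    (h : thm122b_rankOne_charIdeal_torsion_eq_heegnerCharIdeal_sq N W K p κ γ jbar) :
    thm122b_rankOne_charIdeal_torsion_eq_heegnerCharIdeal_sq_minimal N W K p κ γ jbar :=
  fun hyp hs D F _ _ X ↦ h hyp hs D F X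


/-- **Burungale–Castella–Skinner 2025, Theorem 4.2.1 (a), rational clause (§4.2, p. 8)** — the
"upper bound" half of Perrin-Riou's statement under (irr_K), for the newform of an elliptic curve:
"Let `g ∈ S₂(Γ₀(N))` be an elliptic newform and `p` an odd prime of good ordinary reduction for `g`.
Let `K` be an imaginary quadratic field satisfying (disc), (Heeg), and (irr_K). Then … (a) Both
`X^ord(g/K_∞⁻)` and `H¹_{F_Λ}(K, T_g ⊗ Λ_K⁻)` have `Λ_K⁻`-rank one, and `ch(X^ord(g/K_∞⁻)_tor) ⊃
ch(H¹_{F_Λ}(K, T_g ⊗ Λ_K⁻)/(κ_1^Heeg))²` in `Λ_K⁻ ⊗ ℚ_p`" ("Part (a) is contained in [CGS23,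
Thm. 5.5.2]"). Transcribed for `g = f_E` (module docstring items 1–6): `E/ℚ` elliptic of conductor
`N`, `p ≠ 2` good ordinary, (disc), (Heeg), (irr_K) `ρ̄_E|_{G_K}` irreducible, `p ∤ h_K` (EXTRA), NO
(spl), NO `p > 3` — valid at `p = 3`: `D.S`, `X.X` finitely generated of rank one and
`c · heegnerCharIdeal² ⊆ ch(X_tors)` for some `0 ≠ c ∈ ℤ_p` (Howard's divisibility (c) after
`⊗ ℚ_p`). The integral clause "if (sur) holds … integrally" is [How04, Thm. B] = tree fact
`Howard2004_thmB` and is NOT restated here. PUBLISHED. Special case `p ∤ h_K`, `g = f_E`.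
-- TODO(general form): `g` a weight-two newform with arbitrary Hecke field (`T_g`, `𝒪`-lattices).
[cite: BurungaleCastellaSkinner2025, Thm. 4.2.1 (a) (§4.2, p. 8 of arXiv:2405.00270v2) with (irr_K) (p. 7)]
[cite: CastellaGrossiSkinner2025, Thm. 5.5.2 (the source, as cited by BCS)]
[cite: Howard2004HeegnerKolyvagin, Thm. 3.3.7 (transcription of Λκ_1^Heeg as the Heegner module)] -/
def thm421a_rankOne_heegnerCharIdeal_sq_le_rat : Prop :=
  ∀ (_ : W.IsElliptic), N = W.conductorNorm ℤ → p ≠ 2 → GoodOrd W p →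
    IsImaginaryQuadratic K → Odd (discr K) → discr K ≠ -3 → SatisfiesHeegnerHypothesis N K →
    (W.baseChange K).HasIrreducibleModPGaloisRep p → ¬ p ∣ classNumber K →
    κ.IsAnticyclotomic → κ.IsTopGenerator γ →
    ∀ (D : (W.baseChange K).LambdaAdicSelmerData κ γ) (F : HeegnerFamily N W K κ jbar)
      (X : (W.baseChange K).SelmerDualData κ γ),
    (Module.Finite (IwasawaAlgebra p) D.S ∧ Module.finrank (IwasawaAlgebra p) D.S = 1) ∧
    (Module.Finite (IwasawaAlgebra p) X.X ∧ Module.finrank (IwasawaAlgebra p) X.X = 1) ∧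
    ∃ c : ℤ_[p], c ≠ 0 ∧
      Ideal.span {(PowerSeries.C c : IwasawaAlgebra p)} * heegnerCharIdeal D F ^ 2 ≤
        Module.charIdeal (IwasawaAlgebra p) (Submodule.torsion (IwasawaAlgebra p) X.X)

variable {N W K p κ γ jbar}

omit [NeZero N] in
/-- `Thm122Hypotheses` make `p` odd (`3 < p`) and `D_K ≠ -4` (`D_K` odd) — so the data lie inside
Howard's / Perrin-Riou's standing exclusions `p ≠ 2`, `D_K ∉ {-3, -4}`.
[cite: BurungaleCastellaSkinner2025, Thm. 1.2.2 (data)] -/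
theorem Thm122Hypotheses.p_ne_two_and_discr_ne_neg_four (hyp : Thm122Hypotheses N W K p κ γ) :
    p ≠ 2 ∧ discr K ≠ -4 := by
  refine ⟨by have := hyp.three_lt; omega, fun h ↦ ?_⟩
  have hodd := hyp.discr_odd
  rw [h] at hodd
  exact (Int.not_odd_iff_even.2 ⟨-2, by norm_num⟩) hodd

/-- **Theorem 1.2.2 (b) ⇒ Theorem 1.2.2 (a)'s conclusion on the (sur)-locus** (with `c = 1`): the
integral equality gives both rational containments. Bookkeeping only.
[cite: BurungaleCastellaSkinner2025, Thm. 1.2.2 (§1.2, p. 3)] -/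
theorem rat_of_thm122b (h : thm122b_rankOne_charIdeal_torsion_eq_heegnerCharIdeal_sq N W K p κ γ jbar)
    (hyp : Thm122Hypotheses N W K p κ γ) (hsur : Surj W p)
    (D : (W.baseChange K).LambdaAdicSelmerData κ γ) (F : HeegnerFamily N W K κ jbar)
    (X : (W.baseChange K).SelmerDualData κ γ) :
    (Module.Finite (IwasawaAlgebra p) D.S ∧ Module.finrank (IwasawaAlgebra p) D.S = 1) ∧
    (Module.Finite (IwasawaAlgebra p) X.X ∧ Module.finrank (IwasawaAlgebra p) X.X = 1) ∧
    ∃ c : ℤ_[p], c ≠ 0 ∧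
      Ideal.span {(PowerSeries.C c : IwasawaAlgebra p)} *
          Module.charIdeal (IwasawaAlgebra p) (Submodule.torsion (IwasawaAlgebra p) X.X) ≤
        heegnerCharIdeal D F ^ 2 ∧
      Ideal.span {(PowerSeries.C c : IwasawaAlgebra p)} * heegnerCharIdeal D F ^ 2 ≤
        Module.charIdeal (IwasawaAlgebra p) (Submodule.torsion (IwasawaAlgebra p) X.X) := by
  obtain ⟨hS, hX, hX1, heq⟩ := h hyp hsur D F X
  refine ⟨hS, ⟨hX, hX1⟩, 1, one_ne_zero, ?_, ?_⟩
  · rw [map_one, Ideal.span_singleton_one, Ideal.top_mul, heq]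
  · rw [map_one, Ideal.span_singleton_one, Ideal.top_mul, heq]

/-- **Theorem 1.2.2 (b) ⇒ both divisibilities** `ch(X_tors) ∣ heegnerCharIdeal²` (Howard's (c),
the third clause of `Howard2004_thmB`) and `heegnerCharIdeal² ∣ ch(X_tors)` (the "lower bound",
not available from a Kolyvagin-system argument alone).
[cite: BurungaleCastellaSkinner2025, Thm. 1.2.2 (b) (§1.2, p. 3)] -/
theorem dvd_and_dvd_of_thm122b
    (h : thm122b_rankOne_charIdeal_torsion_eq_heegnerCharIdeal_sq N W K p κ γ jbar)
    (hyp : Thm122Hypotheses N W K p κ γ) (hsur : Surj W p)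
    (D : (W.baseChange K).LambdaAdicSelmerData κ γ) (F : HeegnerFamily N W K κ jbar)
    (X : (W.baseChange K).SelmerDualData κ γ) :
    Module.charIdeal (IwasawaAlgebra p) (Submodule.torsion (IwasawaAlgebra p) X.X) ∣
        heegnerCharIdeal D F ^ 2 ∧
      heegnerCharIdeal D F ^ 2 ∣
        Module.charIdeal (IwasawaAlgebra p) (Submodule.torsion (IwasawaAlgebra p) X.X) :=
  ⟨dvd_of_eq (h hyp hsur D F X).2.2.2, dvd_of_eq (h hyp hsur D F X).2.2.2.symm⟩

/-- **Theorem 1.2.2 (a) ⇒ the hypothesis `hMC`** of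
`heegnerModuleIndex_eq_zero_of_rational_mainConjecture` ("the rational Heegner point main
conjecture in the direction opposite to Howard's (c)": `c · ch(X_tors) ⊆ I(ℋ_∞)²`, `c ≠ 0`), for
`p > 3` good ordinary with (irr_ℚ), (disc), (Heeg), (spl), `p ∤ h_K`.
[cite: BurungaleCastellaSkinner2025, Thm. 1.2.2 (a) (§1.2, p. 3)] -/
theorem exists_C_mul_charIdeal_le_of_thm122a
    (h : thm122a_rankOne_charIdeal_torsion_eq_heegnerCharIdeal_sq_rat N W K p κ γ jbar)
    (hyp : Thm122Hypotheses N W K p κ γ) (hirr : Irr W p)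
    (D : (W.baseChange K).LambdaAdicSelmerData κ γ) (F : HeegnerFamily N W K κ jbar)
    (X : (W.baseChange K).SelmerDualData κ γ) :
    ∃ c : ℤ_[p], c ≠ 0 ∧
      Ideal.span {(PowerSeries.C c : IwasawaAlgebra p)} *
          Module.charIdeal (IwasawaAlgebra p) (Submodule.torsion (IwasawaAlgebra p) X.X) ≤
        heegnerCharIdeal D F ^ 2 := by
  obtain ⟨-, -, c, hc, hle, -⟩ := h hyp hirr D F X
  exact ⟨c, hc, hle⟩

/-- **Theorem 4.2.1 (a) on the data of Theorem 1.2.2**: under `Thm122Hypotheses` (which carry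
`p ≠ 2`, (disc), (Heeg), `p ∤ h_K`, good ordinary) and (irr_K), the rational "upper bound"
`c · heegnerCharIdeal² ⊆ ch(X_tors)` — the half of Thm. 1.2.2 (a) that comes from the Kolyvagin
system (the other half is the base-change input). Bookkeeping only.
[cite: BurungaleCastellaSkinner2025, Thm. 4.2.1 (a) (§4.2, p. 8), proof of Thm. 1.2.2 (p. 11)] -/
theorem exists_C_mul_heegnerCharIdeal_sq_le_of_thm421a
    (h : thm421a_rankOne_heegnerCharIdeal_sq_le_rat N W K p κ γ jbar)
    (hyp : Thm122Hypotheses N W K p κ γ) (hirrK : (W.baseChange K).HasIrreducibleModPGaloisRep p)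
    (D : (W.baseChange K).LambdaAdicSelmerData κ γ) (F : HeegnerFamily N W K κ jbar)
    (X : (W.baseChange K).SelmerDualData κ γ) :
    ∃ c : ℤ_[p], c ≠ 0 ∧
      Ideal.span {(PowerSeries.C c : IwasawaAlgebra p)} * heegnerCharIdeal D F ^ 2 ≤
        Module.charIdeal (IwasawaAlgebra p) (Submodule.torsion (IwasawaAlgebra p) X.X) :=
  (h hyp.isElliptic hyp.level hyp.p_ne_two_and_discr_ne_neg_four.1 hyp.goodOrd
    hyp.isImaginaryQuadratic hyp.discr_odd hyp.discr_ne hyp.heegner hirrK hyp.not_dvd_classNumber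
    hyp.anticyclotomic hyp.topGenerator D F X).2.2

end Literature.NumberTheory.EllipticCurves.BurungaleCastellaSkinner2025

end
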